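import Mathlib
import Literature.Probability.Percolation.QuadCrossingSpace
import Summits.CriticalPhenomena.CardyFormulaZ2.Theses.CardySelfRefinement

/-!
Sketch for crux-ideate stmt-CriticalPhenomena-10265 (ScaleInvariantLimits), ideator 2, round 1.
First lemmas of the two idea cards `spiral-self-similarity-2-plus-i` and
`magic-fibre-no-dilation-arcs`, plus three support statements about the dilation orbit.
-/

open scoped Topology
open Set Filter MeasureTheory
open Literature.Probability.Percolation Literature.Probability.Percolation.QuadCrossing

namespace Summit.CriticalPhenomena.CardyFormulaZ2.Cruxes.ScaleInvariantLimits.IdeatorTwo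

/-- Laws on the Schramm–Smirnov space of the whole plane. -/
abbrev Law := FiniteMeasure (QuadConfig (univ : Set ℂ))

/-- `Λ`, the set of subsequential quad-crossing limits of bond-ℤ² at `p = 1/2`. -/
abbrev Λ : Set Law := subseqQuadLimits (univ : Set ℂ)

/-- The dilation orbit `t ↦ S_t μ` of a law (junk value `μ` for `t ≤ 0`). -/
noncomputable def orbit (μ : Law) (t : ℝ) : Law :=
  if ht : 0 < t then dilateLaw t ht.ne' μ else μ

/-- (S1) ORBIT EXACTNESS: the lattice laws form ONE orbit of the dilation flow,
`S_t μ_δ = μ_{tδ}` (the realisation map `z` is linear, so `configOf z (tδ) ω = S_t (configOf z δ ω)`).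
Consequence: `Λ` is the ω-limit set of the point `μ_1` under the flow `S`. -/
def OrbitExact : Prop :=
  ∀ (δ t : ℝ) (_hδ : 0 < δ) (ht : 0 < t),
    dilateLaw t ht.ne' (squareCrossingLaw (univ : Set ℂ) δ) = squareCrossingLaw (univ : Set ℂ) (t * δ)

/-- (S2) ORBIT CONTINUITY: `t ↦ S_t μ` is weakly continuous on `(0,∞)` for every law `μ`
(continuity of `(t,S) ↦ S_t S` on `ℋ`, checked on the subbase `V_U`, `V^Q`, then dominated
convergence).  This is the lemma refuter g41-35 flagged as missing for `TwoLagsAllLags`. -/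
def OrbitContinuous : Prop := ∀ μ : Law, ContinuousOn (orbit μ) (Ioi 0)

/-- (S3) `Λ` is invariant under every dilation (from (S1): `S_t` of a limit along `δ_k` is the
limit along `t δ_k`, push-forward by the homeomorphism `S_t` being weakly continuous). -/
def LimitSetInvariant : Prop := ∀ μ ∈ Λ, ∀ (t : ℝ) (ht : 0 < t), dilateLaw t ht.ne' μ ∈ Λ

/-! ### Card `magic-fibre-no-dilation-arcs` — first lemma (closing lemma, provable now) -/

/-- `M` carries NO DILATION ARCS: every continuous dilation orbit that stays inside `M` is
constant.  The card's crux is this property for `M = 𝓜 ∩ 𝒩` (magic fibre ∩ percolation-type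
black noises). -/
def NoDilationArcs (M : Set Law) : Prop :=
  ∀ μ ∈ M, (∀ (t : ℝ) (ht : 0 < t), dilateLaw t ht.ne' μ ∈ M) →
    ContinuousOn (orbit μ) (Ioi 0) → ∀ (t : ℝ) (ht : 0 < t), dilateLaw t ht.ne' μ = μ

/-- Closing lemma: if `Λ ⊆ M` for a dilation-arc-free `M`, the crux follows. -/
theorem scaleInvariantLimits_of_noDilationArcs (M : Set Law) (hM : NoDilationArcs M)
    (hΛ : Λ ⊆ M) (hinv : LimitSetInvariant) (hcont : OrbitContinuous) :
    Theses.CardySelfRefinement.ScaleInvariantLimits := by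
  intro μ hμ t ht
  exact hM μ (hΛ hμ) (fun s hs => hΛ (hinv μ hμ s hs)) (hcont μ) t ht

/-- The topological lever: a totally disconnected `M` carries no dilation arcs
(a continuous image of `(0,∞)` is preconnected, hence a point). -/
theorem noDilationArcs_of_isTotallyDisconnected (M : Set Law) (hM : IsTotallyDisconnected M)
    (h1 : ∀ μ : Law, dilateLaw 1 one_ne_zero μ = μ) : NoDilationArcs M := by
  intro μ _hμM horb hcont t ht
  have hpre : IsPreconnected (orbit μ '' Ioi 0) := isPreconnected_Ioi.image _ hcont
  have hsub : orbit μ '' Ioi 0 ⊆ M := by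
    rintro _ ⟨s, hs, rfl⟩
    have hs' : (0 : ℝ) < s := hs
    simp only [orbit, dif_pos hs']
    exact horb s hs'
  have hss := hM _ hsub hpre
  have ht' : orbit μ t = orbit μ 1 := hss ⟨t, ht, rfl⟩ ⟨1, Set.mem_Ioi.mpr one_pos, rfl⟩
  simp only [orbit, dif_pos ht, dif_pos one_pos] at ht'
  rw [ht', h1]

/-! ### Card `spiral-self-similarity-2-plus-i` — first lemma and the routing check -/

/-- `arg (2 + i)`. -/
noncomputable def spiralAngle : ℝ := Real.arctan (1 / 2)

lemma sqrt_five_ne_zero : Real.sqrt 5 ≠ 0 := (Real.sqrt_pos.mpr (by norm_num)).ne'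

/-- DYADIC LAG (delivered by the route's `k = 2` engine: `LagsToInvariance` restricted to 2). -/
def DyadicLag : Prop := ∀ μ ∈ Λ, dilateLaw 2 two_ne_zero μ = μ

/-- SPIRAL LAG: every subsequential limit is invariant under the spiral similarity
`z ↦ (2+i) z = √5 · e^{i·arctan(1/2)} · z`, the exact self-similarity of `ℤ² = ℤ[i]` realised
inside `ℤ²` by the vertex-perfect zigzag refinement of index `5 = 1² + 2²` (the card's engine:
the route's interpolation run on `M_{2+i}(ρ,c)` instead of `M_3`). -/
def SpiralLag : Prop :=
  ∀ μ ∈ Λ, isometryLaw (rotation (Circle.exp spiralAngle)).toIsometryEquiv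
      (dilateLaw (Real.sqrt 5) sqrt_five_ne_zero μ) = μ

/-- FIRST LEMMA of the spiral card (provable now): dyadic lag + spiral lag + DKKMO rotation input
+ orbit continuity ⇒ the crux.  Proof sketch: `RotationInput` strips the rotation from the spiral
lag, so the closed multiplicative subgroup `{t > 0 : S_t = id on Λ}` contains `2` and `√5`;
`log 5 / (2 log 2) ∉ ℚ` (else `5^q = 2^{2p}`), so the subgroup is dense, and closed
(`OrbitContinuous`), hence everything (Mathlib `AddSubgroup.dense_or_cyclic` on logarithms). -/
def SpiralLagsAllLags : Prop :=
  DyadicLag → SpiralLag → Theses.CardySelfRefinement.RotationInput → OrbitContinuous →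
    Theses.CardySelfRefinement.ScaleInvariantLimits

/-- THE ROUTING CHECK (decidable): the zigzag realisation of the coarse edges `v → v+(2,1)`
(steps R,U,R; private interior vertices `v+(1,0)`, `v+(1,1)`) and `v → v+(-1,2)` (steps U,L,U;
private interior vertices `v+(0,1)`, `v+(-1,1)`) uses, together with `v` itself, exactly one
representative of each class of `ℤ² / (2+i)ℤ² ≅ ℤ/5` (identify `(a,b) ↦ a + 3b mod 5`, since
`i ≡ -2 ≡ 3`): the refinement is VERTEX-PERFECT (no interior vertices, `5 = 1 + 2·2`). -/
theorem zigzag_routing_perfect :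
    ((([((0 : ℤ), (0 : ℤ)), (1, 0), (1, 1), (0, 1), (-1, 1)] : List (ℤ × ℤ)).map
      (fun p => (p.1 + 3 * p.2) % 5)).Nodup) := by decide

/-- Arithmetic behind density of the two lags: `log √5 / log 2 ∉ ℚ`, i.e. no positive integers
`p, q` with `5 ^ q = 2 ^ (2 * p)` (parity of the `2`-adic valuation). Stated; routine. -/
def SpiralLagIrrational : Prop := ∀ p q : ℕ, 0 < q → (5 : ℕ) ^ q ≠ 2 ^ (2 * p)

/-- SPIRAL INVARIANCE ALONE GIVES ALL ROTATIONS.  Exact reflection symmetry of bond-ℤ²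
(`σ z = conj z` preserves `δℤ²`, so every subsequential limit is `σ`-invariant): -/
def ReflectionExact : Prop :=
  ∀ μ ∈ Λ, isometryLaw Complex.conjLIE.toIsometryEquiv μ = μ

/-- Continuity of the rotation orbit `α ↦ (R_α)_* μ` of a law (same proof pattern as (S2)). -/
def RotationOrbitContinuous : Prop :=
  ∀ μ : Law, Continuous (fun α : ℝ => isometryLaw (rotation (Circle.exp α)).toIsometryEquiv μ)

/-- `(3+4i)/5 = (2+i)/(2-i)` is not a root of unity (`ℤ[i]` is a UFD and `2 ± i` are
non-associate primes), i.e. the rotation angle `2·arctan(1/2)` is an irrational multiple of `π`. -/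
def SpiralAngleIrrational : Prop :=
  ∀ n : ℕ, 0 < n → ((3 : ℂ) + 4 * Complex.I) ^ n ≠ (5 : ℂ) ^ n

/-- SECOND LEMMA of the spiral card (provable now): `T_{2-i} = σ ∘ T_{2+i} ∘ σ`, so `SpiralLag`
and `ReflectionExact` give invariance of every `μ ∈ Λ` under `T_{2+i} ∘ T_{2-i}⁻¹ = R_{2α₀}`, a
rotation by an irrational angle; with `RotationOrbitContinuous` the stabiliser is a closed subgroup
of `SO(2)` containing a dense one: DKKMO's rotation input becomes OUTPUT of the self-refinement
engine run on one Gaussian prime. -/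
def SpiralGivesRotations : Prop :=
  SpiralLag → ReflectionExact → RotationOrbitContinuous → SpiralAngleIrrational →
    Theses.CardySelfRefinement.RotationInput

/-- A second Gaussian prime of independent norm, `3 + 2i` (index 13; coarse edge = 5 lattice
steps with 4 private interior vertices, `1 + 2·4 = 9 ≤ 13`, so vertex-disjointly realisable):
invariance of `Λ` under `T_{3+2i}`. -/
def SpiralLag13 : Prop :=
  ∀ μ ∈ Λ, isometryLaw (rotation (Circle.exp (Real.arctan (2 / 3)))).toIsometryEquiv
      (dilateLaw (Real.sqrt 13) (Real.sqrt_pos.mpr (by norm_num)).ne' μ) = μ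

/-- TWO GAUSSIAN PRIMES GIVE THE WHOLE SIMILARITY GROUP (provable now): the closed subgroup of
`ℂˣ` generated by `2 ± i`, `3 ± 2i` is `ℂˣ` (`log 13 / log 5 ∉ ℚ`; rotations dense), hence both
`RotationInput` and the crux, with NO appeal to DKKMO and NO real-integer refinement. -/
def TwoPrimesAllSimilarities : Prop :=
  SpiralLag → SpiralLag13 → ReflectionExact → OrbitContinuous → RotationOrbitContinuous →
    SpiralAngleIrrational →
    Theses.CardySelfRefinement.RotationInput ∧ Theses.CardySelfRefinement.ScaleInvariantLimits

end Summit.CriticalPhenomena.CardyFormulaZ2.Cruxes.ScaleInvariantLimits.IdeatorTwo
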